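/-
Copyright (c) 2026 the pub-hodgecm-mathlib formalisation cell (harness21).  Prover seat hodgecm-mathlib-K2E3-p37 (g0), Track B «K2-LIT» ∕ h413 =
`stmt-HodgeConjecture-24833`, line `K2_E3_EllipticInputs`, unit U4 «Keys», PART «U4Keys» socket :182 (U4f-χ₁-ram-one-pos)
`sig_K2E3KeysThmTwoContractingRamifiedCharOnePosDepth` (LINE-LEAD K2E3-plan (g4) L4∕E3 EMIT #5 deal D163 2026-09-04T15:31:56Z; R0 census
`K2/K2E3-p37/g0/CENSUS-U4f-PosDepth.K2E3-p37-g0.md`): programme A_pos brick (i) «THE LEVEL-`n` IWAHORI `J_n = K₀ ⊓ g_n K₀ g_n⁻¹` OF `U(σ, Φ₃)(K)` AND ITS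
IWAHORI FACTORISATION» — the `n`-twin of ★ `K2E3IwahoriFactorisationThree` (K2E3-p05 (g2); `n = 1`, `J_1 = I`).  REPORT-FIRST 2026-09-04.
-/
import Literature.NumberTheory.Automorphic.UnitaryBruhatIwahoriThree      -- ★ (LH5-p05): `K₀` tests, `coe_inv_apply_eq`, `not_forall_v_apply_lt_one_of_mem_glInt_subgroupOf`; brings ★ Iwasawa ∕ BigCell (`col_zero_isotropic`, `exists_coe_eq_lower`, `sum_rel_of_mem`)
import Literature.NumberTheory.Automorphic.CMPrincipalSeriesSpherical     -- ★ `val_proj_borelTriple` (the Levi projection reads off the diagonal)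
import HarnessLib

/-!
# K2 ∕ E3 «EllipticInputs», unit U4 «Keys» — (U4f-χ₁-ram-one-pos), programme A_pos brick (i): THE LEVEL-`n` IWAHORI SUBGROUP `J_n = K₀ ⊓ g_n K₀ g_n⁻¹`
# OF `U(σ, Φ₃)(K)` (`g_n = diag(1, 1, ϖⁿ)`) — the entry test and the Iwahori factorisation `J_n = (J_n ∩ N̄)·(J_n ∩ T)·(J_n ∩ N)`
# [BruhatTits1972 (4.4.3)–(4.4.4); Casselman1995 Prop. 1.4.4; Roche1998 §2–§3; Tits1979 §3.7]

Cell hodgecm-mathlib, Track B «K2-LIT», crux item H413 = stmt-HodgeConjecture-24833 (route `HCCMUnconditional`, no route verbs); target BY NAME the OPEN tier-0 leaf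
`…K2E3EllipticInputs.U4Keys.sig_K2E3KeysThmTwoContractingRamifiedCharOnePosDepth` (U4Keys ED. 8 :182; Keys §7 Thm (2) for `χ₁` of POSITIVE depth).  Author K2E3-p37 (g0).
`--supports stmt-HodgeConjecture-24833 --as helper`; THEOREMS ONLY (no `def`, no `instance`, no `notation`, no named fact, no `sorry`); MODEL level (`U(σ, Φ₃)(K)`, `K` with
`Valued K ℤᵐ⁰`, ANY isometric involution `σ`, a uniformiser `ϖ`; letters of ★ `UnitaryIwahoriSubgroupThree`: `hσ hvσ hvϖ; hJ; gn hgn`).  NOT THE PAYER of :182.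

THE POINT.  Design D-I «vanishing functional» (★ `K2E3BranchAContradiction`, K2E3-p06 (g4)) proved Branch A of Keys' theorem at depth ZERO with the Iwahori `I = K₀ ⊓ K₁`
(`K₁ = g₁K₀g₁⁻¹`, `g₁ = diag(1,1,ϖ)`) as the compact open carrying the `χ`-type vector.  At POSITIVE depth `n` (= the conductor of `χ₁`) the type vector lives on the LEVEL-`n`
IWAHORI `J_n := K₀ ⊓ g_nK₀g_n⁻¹`, `g_n = diag(1,1,ϖⁿ)`: the integral unitary matrices whose three strictly-lower entries lie in `𝔭ⁿ` (§1), on which `θ(n̄ t n) := χ₁(t₀₀)` is a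
character once cond `χ₁ ≤ n`.  Every consumer — the D-I engine at level `n`, a types road (Roche ∕ Blondel), or Road I's level-`n` type vector (D59 (M3)) — needs the
IWAHORI FACTORISATION of `J_n` (the `factorization` field of ★ `ParabolicTriple.IwahoriDatum`), which this file proves for EVERY `n` exactly as ★ `K2E3IwahoriFactorisationThree`
does at `n = 1`: for `g ∈ J_n` the pivot `g₀₀` is a unit (§2, `1 ≤ n`); `n̄ := ū(p, q)`, `p = -σg₁₀∕σg₀₀`, `q = g₂₀∕g₀₀` (unitary by the isotropy of the first column ★
`col_zero_isotropic`; `|p|, |q| ≤ |ϖ|ⁿ`, so `n̄ ∈ J_n` by the test) makes `b := n̄⁻¹ g` upper triangular (its first column is `(g₀₀, 0, 0)`; `b₂₁ = 0` by the `(0,1)` Hermitian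
relation ★ `sum_rel_of_mem`), and `b = m · n` with `m = proj b = diag(bᵢᵢ) ∈ J_n ∩ T` (★ `val_proj_borelTriple`), `n = m⁻¹ b ∈ J_n ∩ N`.
* §1 `coe_inv_eq_diagonal_of_eq_pow`, `coe_conj_apply_of_eq_pow`, `v_pow_inv_mul_le_iff`, **`mem_glInt_inf_conj_glInt_pow_iff`** (THE LEVEL-`n` TEST: `k ∈ J_n ↔` integral
  `∧ |k₂₀|, |k₂₁|, |k₁₀| ≤ |ϖ|ⁿ`), `mem_glInt_inf_conj_glInt_pow_of_diagonal` (integral diagonal unitaries lie in every `J_n`).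
* §2 `v_apply_zero_zero_eq_one_of_mem_inf_pow` (the pivot, `1 ≤ n`).
* §3 `exists_lowerU_mul_borel_of_mem_inf_pow` (`g = n̄ b`), **`exists_nbar_mul_torus_mul_unipotent_of_mem_inf_pow`** (`g = n̄ m n`), **`coe_inf_pow_eq_mul`** (the set identity
  `J_n = (J_n ∩ N̄)(J_n ∩ T)(J_n ∩ N)` in the datum's letters `(borelTriple σ J hJ).M ∕ .N`, `N̄ = N.map (conj w)`).
HONEST LABEL: HC_CM is proved only modulo the 7 printed citations (2 remaining named inputs: hLiu418 = stmt-HodgeConjecture-24832, h413 = stmt-HodgeConjecture-24833)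
until rung 0 closes; count-neutral (group theory; no printed citation is discharged; the leaf :182 stays OPEN — see the R0 census for the A_pos ∕ B_pos state).

## References
* [BruhatTits1972] F. Bruhat, J. Tits, *Groupes réductifs sur un corps local I*, Publ. Math. IHÉS 41 (1972), (4.4.3)–(4.4.4) (factorisation of the groups `P_Ω`).
* [Casselman1995] W. Casselman, *Introduction to the theory of admissible representations of `p`-adic reductive groups* (1995), Prop. 1.4.4 (Iwahori factorisation of `K_n`-type groups).
* [Roche1998] A. Roche, *Types and Hecke algebras for principal series representations of split reductive p-adic groups*, Ann. Sci. ÉNS (4) 31 (1998), §2–§3 (the groups `J_χ`).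
* [Tits1979] J. Tits, *Reductive groups over local fields*, Proc. Symp. Pure Math. 33.1 (1979), §3.7.
* [Rogawski1990] J. D. Rogawski, *Automorphic Representations of Unitary Groups in Three Variables* (1990), §1.9–§1.10 pp. 8–9.
-/

set_option autoImplicit false
-- the mandated namespace repeats the single-problem summit's segment (`HodgeConjecture.HodgeConjecture`)
set_option linter.dupNamespace false

noncomputable section

open Matrix Literature.NumberTheory.Automorphic Literature.NumberTheory.Automorphic.UnitaryGroup
open scoped Matrix MatrixGroups WithZero Pointwise

namespace Summit.HodgeConjecture.HodgeConjecture.Cruxes.H413.K2E3IwahoriLevelNFactorisation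

variable {K : Type*} [Field K] [Valued K ℤᵐ⁰] [ValuativeRel K] [(Valued.v : Valuation K ℤᵐ⁰).Compatible]
  (σ : K →+* K) {ϖ : K} {J : Matrix (Fin 3) (Fin 3) K} (hJ : J = (StdForm.antidiagonal 3).over K)
  (hσ : ∀ a, σ (σ a) = a) (hvσ : ∀ a, Valued.v (σ a) = Valued.v a) (hvϖ : Valued.v ϖ = WithZero.exp (-1 : ℤ))
  {n : ℕ} (gn : GL (Fin 3) K) (hgn : (gn : Matrix (Fin 3) (Fin 3) K) = Matrix.diagonal ![(1 : K), 1, ϖ ^ n])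

/-! ## §1 The level-`n` test: `k ∈ J_n = K₀ ⊓ g_n K₀ g_n⁻¹ ↔` integral with `|k₂₀|, |k₂₁|, |k₁₀| ≤ |ϖ|ⁿ` -/

omit [Valued K ℤᵐ⁰] [ValuativeRel K] [(Valued.v : Valuation K ℤᵐ⁰).Compatible] in
include hgn in
/-- The matrix of `g_n⁻¹` for `g_n = diag(1,1,ϖⁿ)`, `ϖ ≠ 0`: `diag(1,1,(ϖⁿ)⁻¹)`. [cite: BruhatTits1972, (4.4.3)] -/
theorem coe_inv_eq_diagonal_of_eq_pow (hϖ0 : ϖ ≠ 0) :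
    ((gn⁻¹ : GL (Fin 3) K) : Matrix (Fin 3) (Fin 3) K) = Matrix.diagonal ![(1 : K), 1, (ϖ ^ n)⁻¹] := by
  have hϖn0 : ϖ ^ n ≠ 0 := pow_ne_zero n hϖ0
  rw [Matrix.coe_units_inv, hgn]
  refine Matrix.inv_eq_left_inv ?_
  rw [Matrix.diagonal_mul_diagonal, ← Matrix.diagonal_one]
  congr 1
  funext i
  fin_cases i <;> simp [hϖn0]

omit [Valued K ℤᵐ⁰] [ValuativeRel K] [(Valued.v : Valuation K ℤᵐ⁰).Compatible] in
include hgn in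
/-- Entries of `g_n⁻¹ x g_n` for `g_n = diag(d)`, `d = (1,1,ϖⁿ)`: `(dᵢ)⁻¹ xᵢⱼ dⱼ`. [cite: BruhatTits1972, (4.4.3)] -/
theorem coe_conj_apply_of_eq_pow (hϖ0 : ϖ ≠ 0) (x : GL (Fin 3) K) (i j : Fin 3) :
    ((gn⁻¹ * x * gn : GL (Fin 3) K) : Matrix (Fin 3) (Fin 3) K) i j =
      (![(1 : K), 1, ϖ ^ n] i)⁻¹ * (x : Matrix (Fin 3) (Fin 3) K) i j * ![(1 : K), 1, ϖ ^ n] j := by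
  rw [Units.val_mul, Units.val_mul, coe_inv_eq_diagonal_of_eq_pow gn hgn hϖ0, hgn, Matrix.mul_diagonal, Matrix.diagonal_mul]
  congr 2
  fin_cases i <;> simp

omit [ValuativeRel K] [(Valued.v : Valuation K ℤᵐ⁰).Compatible] in
/-- `|(ϖⁿ)⁻¹ x| ≤ 1 ↔ |x| ≤ |ϖ|ⁿ` (`ϖ ≠ 0`). [cite: Tits1979, §3.3.1] -/
theorem v_pow_inv_mul_le_iff (hϖ0 : ϖ ≠ 0) (x : K) :
    Valued.v ((ϖ ^ n)⁻¹ * x) ≤ 1 ↔ Valued.v x ≤ Valued.v ϖ ^ n := by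
  have hvϖ0 : Valued.v ϖ ≠ 0 := (Valuation.ne_zero_iff _).2 hϖ0
  have hpos : 0 < Valued.v ϖ ^ n := pow_pos (zero_lt_iff.2 hvϖ0) n
  rw [map_mul, map_inv₀, map_pow, inv_mul_le_iff₀ hpos, mul_one]

include hJ hvσ hvϖ hgn in
/-- **THE LEVEL-`n` IWAHORI TEST.**  For `k ∈ U(σ, Φ₃)`: `k ∈ J_n = K₀ ⊓ g_nK₀g_n⁻¹` iff every entry of `k` is integral and the three strictly-lower entries satisfy
`|k₂₀|, |k₂₁|, |k₁₀| ≤ |ϖ|ⁿ` (entries of `g_n⁻¹ k g_n` are `kᵢⱼ dⱼ∕dᵢ`, `d = (1,1,ϖⁿ)`; the `(1,0)` condition is the `(2,1)` entry of `g_n⁻¹ k⁻¹ g_n`, as `(k⁻¹)₂₁ = σ(k₁₀)`).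
At `n = 1` this is ★ `mem_glInt_inf_conj_glInt_iff` (`|x| ≤ |ϖ| ↔ |x| < 1`). [cite: BruhatTits1972, (4.4.3)–(4.4.4)] [cite: Roche1998, §2–§3] [cite: Tits1979, §3.7] -/
theorem mem_glInt_inf_conj_glInt_pow_iff (k : ↥(unitaryGroupOfForm σ J)) :
    k ∈ (glInt 3 K).subgroupOf (unitaryGroupOfForm σ J) ⊓ ((glInt 3 K).map (MulAut.conj gn).toMonoidHom).subgroupOf (unitaryGroupOfForm σ J) ↔
      (∀ i j, Valued.v (((k : GL (Fin 3) K) : Matrix (Fin 3) (Fin 3) K) i j) ≤ 1) ∧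
        Valued.v (((k : GL (Fin 3) K) : Matrix (Fin 3) (Fin 3) K) 2 0) ≤ Valued.v ϖ ^ n ∧
        Valued.v (((k : GL (Fin 3) K) : Matrix (Fin 3) (Fin 3) K) 2 1) ≤ Valued.v ϖ ^ n ∧
        Valued.v (((k : GL (Fin 3) K) : Matrix (Fin 3) (Fin 3) K) 1 0) ≤ Valued.v ϖ ^ n := by
  have hϖ0 : ϖ ≠ 0 := CartanUnique.uniformizer_ne_zero hvϖ
  have hϖn0 : ϖ ^ n ≠ 0 := pow_ne_zero n hϖ0
  have hvϖ1 : Valued.v ϖ ≤ 1 := by rw [hvϖ, ← WithZero.exp_zero, WithZero.exp_le_exp]; norm_num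
  have hvϖn1 : Valued.v (ϖ ^ n) ≤ 1 := by rw [map_pow]; exact pow_le_one' hvϖ1 n
  have key : ∀ x : K, Valued.v ((ϖ ^ n)⁻¹ * x) ≤ 1 ↔ Valued.v x ≤ Valued.v ϖ ^ n := v_pow_inv_mul_le_iff hϖ0
  have key' : ∀ x : K, Valued.v x ≤ 1 → Valued.v (x * ϖ ^ n) ≤ 1 := fun x hx => by
    rw [map_mul]; exact mul_le_one' hx hvϖn1
  have key'' : ∀ x : K, Valued.v x ≤ 1 → Valued.v ((ϖ ^ n)⁻¹ * x * ϖ ^ n) ≤ 1 := fun x hx => by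
    rwa [mul_comm, ← mul_assoc, mul_inv_cancel₀ hϖn0, one_mul]
  have hinv : ∀ i j, (((k : GL (Fin 3) K)⁻¹ : GL (Fin 3) K) : Matrix (Fin 3) (Fin 3) K) i j =
      σ (((k : GL (Fin 3) K) : Matrix (Fin 3) (Fin 3) K) (Fin.rev j) (Fin.rev i)) :=
    fun i j => inv_apply_of_mem σ hJ k i j
  have r0 : Fin.rev (0 : Fin 3) = 2 := rfl
  have r1 : Fin.rev (1 : Fin 3) = 1 := rfl
  have r2 : Fin.rev (2 : Fin 3) = 0 := rfl
  rw [Subgroup.mem_inf, mem_glInt_subgroupOf_iff σ hJ hvσ, mem_conj_glInt_subgroupOf_iff,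
    _root_.Literature.NumberTheory.Automorphic.mem_glInt_iff_forall_v_le_one]
  have hconjinv : (gn⁻¹ * (k : GL (Fin 3) K) * gn)⁻¹ = gn⁻¹ * (k : GL (Fin 3) K)⁻¹ * gn := by group
  simp only [hconjinv, coe_conj_apply_of_eq_pow gn hgn hϖ0, hinv]
  constructor
  · rintro ⟨hint, hfwd, hbwd⟩
    refine ⟨hint, ?_, ?_, ?_⟩
    · have h := hfwd 2 0
      simp only [Matrix.cons_val_zero, Matrix.cons_val, mul_one] at h
      exact (key _).1 h
    · have h := hfwd 2 1
      simp only [Matrix.cons_val_one, Matrix.cons_val, mul_one] at h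
      exact (key _).1 h
    · have h := hbwd 2 1
      simp only [Matrix.cons_val_one, Matrix.cons_val, mul_one, r1, r2] at h
      rw [key, hvσ] at h
      exact h
  · rintro ⟨hint, h20, h21, h10⟩
    have hintσ : ∀ i j, Valued.v (σ (((k : GL (Fin 3) K) : Matrix (Fin 3) (Fin 3) K) i j)) ≤ 1 := fun i j => by
      rw [hvσ]; exact hint i j
    have h20σ : Valued.v (σ (((k : GL (Fin 3) K) : Matrix (Fin 3) (Fin 3) K) 2 0)) ≤ Valued.v ϖ ^ n := by rw [hvσ]; exact h20
    have h10σ : Valued.v (σ (((k : GL (Fin 3) K) : Matrix (Fin 3) (Fin 3) K) 1 0)) ≤ Valued.v ϖ ^ n := by rw [hvσ]; exact h10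
    refine ⟨hint, fun i j => ?_, fun i j => ?_⟩
    · fin_cases i <;> fin_cases j <;>
        simp only [Fin.zero_eta, Fin.mk_one, Fin.reduceFinMk, Matrix.cons_val_zero, Matrix.cons_val_one, Matrix.cons_val,
          inv_one, one_mul, mul_one] <;>
        first | exact hint _ _ | exact (key _).2 h20 | exact (key _).2 h21 | exact key' _ (hint _ _) | exact key'' _ (hint _ _)
    · fin_cases i <;> fin_cases j <;>
        simp only [Fin.zero_eta, Fin.mk_one, Fin.reduceFinMk, Matrix.cons_val_zero, Matrix.cons_val_one, Matrix.cons_val,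
          inv_one, one_mul, mul_one, r0, r1, r2] <;>
        first | exact hintσ _ _ | exact (key _).2 h20σ | exact (key _).2 h10σ | exact key' _ (hintσ _ _) | exact key'' _ (hintσ _ _)

include hJ hvσ hvϖ hgn in
/-- **Integral DIAGONAL unitaries lie in every `J_n`** (their strictly-lower entries vanish) — the Levi factor `J_n ∩ T = T(𝒪)` is level-independent.
[cite: BruhatTits1972, (4.4.4)] [cite: Casselman1995, Prop. 1.4.4] -/
theorem mem_glInt_inf_conj_glInt_pow_of_diagonal {m : ↥(unitaryGroupOfForm σ J)} (hm : m ∈ (glInt 3 K).subgroupOf (unitaryGroupOfForm σ J))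
    {d : Fin 3 → K} (hd : ((m : GL (Fin 3) K) : Matrix (Fin 3) (Fin 3) K) = Matrix.diagonal d) :
    m ∈ (glInt 3 K).subgroupOf (unitaryGroupOfForm σ J) ⊓ ((glInt 3 K).map (MulAut.conj gn).toMonoidHom).subgroupOf (unitaryGroupOfForm σ J) := by
  rw [mem_glInt_inf_conj_glInt_pow_iff σ hJ hvσ hvϖ gn hgn]
  refine ⟨(mem_glInt_subgroupOf_iff σ hJ hvσ m).1 hm, ?_, ?_, ?_⟩ <;>
    · rw [hd, Matrix.diagonal_apply_ne _ (by decide), map_zero]; exact zero_le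

/-! ## §2 The pivot: `g₀₀` is a unit for `g ∈ J_n`, `1 ≤ n` -/

include hJ hvσ hvϖ hgn in
/-- **The `(0,0)` entry of an element of `J_n` (`1 ≤ n`) is a unit.**  `g₁₀, g₂₀ ∈ 𝔭ⁿ ⊆ 𝔭` (the level-`n` test); the last row of `g⁻¹ ∈ K₀` is `(σg₂₀, σg₁₀, σg₀₀)`
(★ `coe_inv_apply_eq`) and no row of an element of `K₀` lies in `𝔭³` (★ `not_forall_v_apply_lt_one_of_mem_glInt_subgroupOf`). [cite: BruhatTits1972, (4.4.4)] [cite: Tits1979, §3.7] -/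
theorem v_apply_zero_zero_eq_one_of_mem_inf_pow (hn : 1 ≤ n) {g : ↥(unitaryGroupOfForm σ J)}
    (hg : g ∈ (glInt 3 K).subgroupOf (unitaryGroupOfForm σ J) ⊓ ((glInt 3 K).map (MulAut.conj gn).toMonoidHom).subgroupOf (unitaryGroupOfForm σ J)) :
    Valued.v (((g : GL (Fin 3) K) : Matrix (Fin 3) (Fin 3) K) 0 0) = 1 := by
  have hvϖ1 : Valued.v ϖ < 1 := by rw [hvϖ, ← WithZero.exp_zero, WithZero.exp_lt_exp]; norm_num
  have hvϖn : Valued.v ϖ ^ n < 1 := pow_lt_one' hvϖ1 (Nat.one_le_iff_ne_zero.1 hn)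
  obtain ⟨hint, h20, -, h10⟩ := (mem_glInt_inf_conj_glInt_pow_iff σ hJ hvσ hvϖ gn hgn g).1 hg
  refine le_antisymm (hint 0 0) ?_
  by_contra h00
  rw [not_le] at h00
  have hK0 : g⁻¹ ∈ (glInt 3 K).subgroupOf (unitaryGroupOfForm σ J) := Subgroup.inv_mem _ (Subgroup.mem_inf.1 hg).1
  refine not_forall_v_apply_lt_one_of_mem_glInt_subgroupOf σ hJ hvσ hK0 2 fun j => ?_
  rw [coe_inv_apply_eq σ hJ g 2 j, hvσ]
  fin_cases j
  · exact h20.trans_lt hvϖn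
  · exact h10.trans_lt hvϖn
  · exact h00

/-! ## §3 `g = n̄ · b`, `g = n̄ · m · n` and the set identity `J_n = (J_n ∩ N̄)(J_n ∩ T)(J_n ∩ N)` -/

include hJ hσ hvσ hvϖ hgn in
set_option maxHeartbeats 1600000 in
-- nine-entry matrix bookkeeping for `n̄⁻¹ g` (three `Fin.sum_univ_three` expansions and the isotropy relation), as in the `n = 1` original
/-- **`g = n̄ · b`** for `g ∈ J_n` (`1 ≤ n`): `n̄ = ū(p, q) ∈ J_n ∩ w N w` with `p = -σg₁₀∕σg₀₀`, `q = g₂₀∕g₀₀` (unitary by the isotropy of the first column of `g`; `|p|, |q| ≤ |ϖ|ⁿ`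
so `n̄ ∈ J_n` by the level-`n` test), and `b = n̄⁻¹ g ∈ J_n` is upper triangular (`b₁₀ = b₂₀ = 0` by construction, `b₂₁ = 0` by the `(0,1)` Hermitian relation).
[cite: BruhatTits1972, (4.4.3)] [cite: Casselman1995, Prop. 1.4.4] [cite: Roche1998, §2–§3] [cite: Rogawski1990, §1.10 p. 9] -/
theorem exists_lowerU_mul_borel_of_mem_inf_pow (hn : 1 ≤ n) {g : ↥(unitaryGroupOfForm σ J)}
    (hg : g ∈ (glInt 3 K).subgroupOf (unitaryGroupOfForm σ J) ⊓ ((glInt 3 K).map (MulAut.conj gn).toMonoidHom).subgroupOf (unitaryGroupOfForm σ J)) :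
    ∃ nb b : ↥(unitaryGroupOfForm σ J),
      nb ∈ (glInt 3 K).subgroupOf (unitaryGroupOfForm σ J) ⊓ ((glInt 3 K).map (MulAut.conj gn).toMonoidHom).subgroupOf (unitaryGroupOfForm σ J) ∧
      nb ∈ ((borelTriple σ J hJ).N).map (MulAut.conj (weylLongU σ hJ)).toMonoidHom ∧
      b ∈ (glInt 3 K).subgroupOf (unitaryGroupOfForm σ J) ⊓ ((glInt 3 K).map (MulAut.conj gn).toMonoidHom).subgroupOf (unitaryGroupOfForm σ J) ∧
      b ∈ borelU σ J ∧ g = nb * b := by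
  have hvϖ1 : Valued.v ϖ ≤ 1 := by rw [hvϖ, ← WithZero.exp_zero, WithZero.exp_le_exp]; norm_num
  have hvϖn1 : Valued.v ϖ ^ n ≤ 1 := pow_le_one' hvϖ1 n
  obtain ⟨hint, h20, h21, h10⟩ := (mem_glInt_inf_conj_glInt_pow_iff σ hJ hvσ hvϖ gn hgn g).1 hg
  have h00 := v_apply_zero_zero_eq_one_of_mem_inf_pow σ hJ hvσ hvϖ gn hgn hn hg
  -- names for the first column
  set a : K := ((g : GL (Fin 3) K) : Matrix (Fin 3) (Fin 3) K) 0 0 with ha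
  set b₁ : K := ((g : GL (Fin 3) K) : Matrix (Fin 3) (Fin 3) K) 1 0 with hb₁
  set c : K := ((g : GL (Fin 3) K) : Matrix (Fin 3) (Fin 3) K) 2 0 with hc
  have ha0 : a ≠ 0 := fun h => by rw [h, map_zero] at h00; exact zero_ne_one h00
  have hσa0 : σ a ≠ 0 := (map_ne_zero σ).2 ha0
  have hiso : σ a * c + σ b₁ * b₁ + σ c * a = 0 := col_zero_isotropic σ hJ g
  -- the lower unitriangular `n̄ = ū(p, q)`
  set p : K := -(σ b₁ / σ a) with hp
  set q : K := c / a with hq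
  have hσp : σ p = -(b₁ / a) := by rw [hp, map_neg, map_div₀, hσ, hσ]
  have hσq : σ q = σ c / σ a := by rw [hq, map_div₀]
  have hrel : q + σ q + p * σ p = 0 := by
    rw [hσq, hσp, hp, hq]
    field_simp
    linear_combination hiso
  obtain ⟨nb, hnb⟩ := exists_coe_eq_lower σ hJ hσ hrel
  have hvp : Valued.v p ≤ Valued.v ϖ ^ n := by
    rw [hp, Valuation.map_neg, map_div₀, hvσ, hvσ, h00, div_one]; exact h10
  have hvq : Valued.v q ≤ Valued.v ϖ ^ n := by
    rw [hq, map_div₀, h00, div_one]; exact h20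
  have hvp1 : Valued.v p ≤ 1 := hvp.trans hvϖn1
  have hvq1 : Valued.v q ≤ 1 := hvq.trans hvϖn1
  have hvσp : Valued.v (-σ p) ≤ Valued.v ϖ ^ n := by rw [Valuation.map_neg, hvσ]; exact hvp
  -- the entries of `n̄`
  have e00 : ((nb : GL (Fin 3) K) : Matrix (Fin 3) (Fin 3) K) 0 0 = 1 := by rw [hnb]; rfl
  have e11 : ((nb : GL (Fin 3) K) : Matrix (Fin 3) (Fin 3) K) 1 1 = 1 := by rw [hnb]; rfl
  have e22 : ((nb : GL (Fin 3) K) : Matrix (Fin 3) (Fin 3) K) 2 2 = 1 := by rw [hnb]; rfl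
  have e01 : ((nb : GL (Fin 3) K) : Matrix (Fin 3) (Fin 3) K) 0 1 = 0 := by rw [hnb]; rfl
  have e02 : ((nb : GL (Fin 3) K) : Matrix (Fin 3) (Fin 3) K) 0 2 = 0 := by rw [hnb]; rfl
  have e12 : ((nb : GL (Fin 3) K) : Matrix (Fin 3) (Fin 3) K) 1 2 = 0 := by rw [hnb]; rfl
  have e10 : ((nb : GL (Fin 3) K) : Matrix (Fin 3) (Fin 3) K) 1 0 = -σ p := by rw [hnb]; rfl
  have e20 : ((nb : GL (Fin 3) K) : Matrix (Fin 3) (Fin 3) K) 2 0 = q := by rw [hnb]; rfl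
  have e21 : ((nb : GL (Fin 3) K) : Matrix (Fin 3) (Fin 3) K) 2 1 = p := by rw [hnb]; rfl
  -- `n̄ ∈ K₀` (all entries integral) and `n̄ ∈ J_n` by the level-`n` test
  have hnbK0 : nb ∈ (glInt 3 K).subgroupOf (unitaryGroupOfForm σ J) := by
    rw [mem_glInt_subgroupOf_iff σ hJ hvσ, hnb]
    intro i j
    fin_cases i <;> fin_cases j <;> simp [hvσ, hvp1, hvq1]
  have hnbI : nb ∈ (glInt 3 K).subgroupOf (unitaryGroupOfForm σ J) ⊓ ((glInt 3 K).map (MulAut.conj gn).toMonoidHom).subgroupOf (unitaryGroupOfForm σ J) := by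
    rw [mem_glInt_inf_conj_glInt_pow_iff σ hJ hvσ hvϖ gn hgn]
    exact ⟨(mem_glInt_subgroupOf_iff σ hJ hvσ nb).1 hnbK0, by rw [e20]; exact hvq, by rw [e21]; exact hvp, by rw [e10]; exact hvσp⟩
  -- `n̄ ∈ N̄ = w N w`
  have hlow : ∀ i j : Fin 3, i < j → ((nb : GL (Fin 3) K) : Matrix (Fin 3) (Fin 3) K) i j = 0 := by
    intro i j hij; rw [hnb]; fin_cases i <;> fin_cases j <;> simp at hij ⊢
  have hdiag : ∀ i : Fin 3, ((nb : GL (Fin 3) K) : Matrix (Fin 3) (Fin 3) K) i i = 1 := by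
    intro i; rw [hnb]; fin_cases i <;> simp
  have hw : weylLongU σ hJ * weylLongU σ hJ = 1 := weylLongU_mul_weylLongU σ hJ
  have hnbN : nb ∈ ((borelTriple σ J hJ).N).map (MulAut.conj (weylLongU σ hJ)).toMonoidHom := by
    refine ⟨weylLongU σ hJ * nb * weylLongU σ hJ, ?_, ?_⟩
    · rw [borelTriple_N]; exact weylLongU_mul_mul_weylLongU_mem_unipotentU σ hJ hlow hdiag
    · change weylLongU σ hJ * (weylLongU σ hJ * nb * weylLongU σ hJ) * (weylLongU σ hJ)⁻¹ = nb
      rw [inv_eq_of_mul_eq_one_right hw, ← mul_assoc, ← mul_assoc, hw, one_mul, mul_assoc, hw, mul_one]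
  -- `b = n̄⁻¹ g`: its first column is `(a, 0, 0)`
  have hinv : ∀ i j, (((nb⁻¹ : ↥(unitaryGroupOfForm σ J)) : GL (Fin 3) K) : Matrix (Fin 3) (Fin 3) K) i j =
      σ (((nb : GL (Fin 3) K) : Matrix (Fin 3) (Fin 3) K) (Fin.rev j) (Fin.rev i)) := fun i j => coe_inv_apply_eq σ hJ nb i j
  have hmul : ∀ i j, (((nb⁻¹ * g : ↥(unitaryGroupOfForm σ J)) : GL (Fin 3) K) : Matrix (Fin 3) (Fin 3) K) i j =
      ∑ k, (((nb⁻¹ : ↥(unitaryGroupOfForm σ J)) : GL (Fin 3) K) : Matrix (Fin 3) (Fin 3) K) i k * ((g : GL (Fin 3) K) : Matrix (Fin 3) (Fin 3) K) k j := by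
    intro i j; rw [Subgroup.coe_mul, Units.val_mul, Matrix.mul_apply]
  have r0 : Fin.rev (0 : Fin 3) = 2 := rfl
  have r1 : Fin.rev (1 : Fin 3) = 1 := rfl
  have r2 : Fin.rev (2 : Fin 3) = 0 := rfl
  have hb10 : (((nb⁻¹ * g : ↥(unitaryGroupOfForm σ J)) : GL (Fin 3) K) : Matrix (Fin 3) (Fin 3) K) 1 0 = 0 := by
    rw [hmul, Fin.sum_univ_three, hinv, hinv, hinv, r0, r1, r2, e21, e11, e01, map_one, map_zero, hσp, ← ha, ← hb₁, ← hc]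
    field_simp
    ring
  have hb20 : (((nb⁻¹ * g : ↥(unitaryGroupOfForm σ J)) : GL (Fin 3) K) : Matrix (Fin 3) (Fin 3) K) 2 0 = 0 := by
    rw [hmul, Fin.sum_univ_three, hinv, hinv, hinv, r0, r1, r2, e20, e10, e00, map_one, map_neg, hσ, hσq, hp, ← ha, ← hb₁, ← hc]
    field_simp
    linear_combination hiso
  -- `b₂₁ = 0` by the `(0,1)` Hermitian relation
  have hb21 : (((nb⁻¹ * g : ↥(unitaryGroupOfForm σ J)) : GL (Fin 3) K) : Matrix (Fin 3) (Fin 3) K) 2 1 = 0 := by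
    have hb00 : (((nb⁻¹ * g : ↥(unitaryGroupOfForm σ J)) : GL (Fin 3) K) : Matrix (Fin 3) (Fin 3) K) 0 0 = a := by
      rw [hmul, Fin.sum_univ_three, hinv, hinv, hinv, r0, r1, r2, e22, e12, e02, map_one, map_zero, ← ha, ← hb₁, ← hc]; ring
    have r := sum_rel_of_mem σ hJ (nb⁻¹ * g) 0 1
    simp only [Fin.sum_univ_three, r0, r1, r2, hb10, hb20, hb00, map_zero, zero_mul, add_zero] at r
    have r' : σ a * (((nb⁻¹ * g : ↥(unitaryGroupOfForm σ J)) : GL (Fin 3) K) : Matrix (Fin 3) (Fin 3) K) 2 1 = 0 := by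
      simpa using r
    exact (mul_eq_zero.1 r').resolve_left hσa0
  refine ⟨nb, nb⁻¹ * g, hnbI, hnbN, Subgroup.mul_mem _ (Subgroup.inv_mem _ hnbI) hg, ?_, by rw [mul_inv_cancel_left]⟩
  rw [mem_borelU_iff]
  intro i j hij
  fin_cases i <;> fin_cases j
  all_goals first | exact absurd hij (by decide) | exact hb10 | exact hb20 | exact hb21

include hJ hσ hvσ hvϖ hgn in
set_option maxHeartbeats 800000 in
-- the Levi projection's matrix and two level-`n` tests
/-- **THE IWAHORI FACTORISATION OF `J_n`, elementwise** (`1 ≤ n`): every `g ∈ J_n` is `n̄ · m · n` with `n̄ ∈ J_n ∩ N̄`, `m ∈ J_n ∩ T`, `n ∈ J_n ∩ N` (`T = (borelTriple σ J hJ).M`,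
`N = (borelTriple σ J hJ).N`, `N̄ = N.map (conj w)`): §3 `g = n̄ b`, then `b = proj b · ((proj b)⁻¹ b)` (★ `ParabolicTriple.proj_inv_mul_mem`) with `proj b = diag(bᵢᵢ)`
integral (★ `val_proj_borelTriple`), hence in `J_n` (§1). [cite: BruhatTits1972, (4.4.3)–(4.4.4)] [cite: Casselman1995, Prop. 1.4.4] [cite: Roche1998, §2–§3] [cite: Tits1979, §3.7] -/
theorem exists_nbar_mul_torus_mul_unipotent_of_mem_inf_pow (hn : 1 ≤ n) {g : ↥(unitaryGroupOfForm σ J)}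
    (hg : g ∈ (glInt 3 K).subgroupOf (unitaryGroupOfForm σ J) ⊓ ((glInt 3 K).map (MulAut.conj gn).toMonoidHom).subgroupOf (unitaryGroupOfForm σ J)) :
    ∃ nb m n : ↥(unitaryGroupOfForm σ J),
      nb ∈ (glInt 3 K).subgroupOf (unitaryGroupOfForm σ J) ⊓ ((glInt 3 K).map (MulAut.conj gn).toMonoidHom).subgroupOf (unitaryGroupOfForm σ J) ∧
      nb ∈ ((borelTriple σ J hJ).N).map (MulAut.conj (weylLongU σ hJ)).toMonoidHom ∧
      m ∈ (glInt 3 K).subgroupOf (unitaryGroupOfForm σ J) ⊓ ((glInt 3 K).map (MulAut.conj gn).toMonoidHom).subgroupOf (unitaryGroupOfForm σ J) ∧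
      m ∈ (borelTriple σ J hJ).M ∧
      n ∈ (glInt 3 K).subgroupOf (unitaryGroupOfForm σ J) ⊓ ((glInt 3 K).map (MulAut.conj gn).toMonoidHom).subgroupOf (unitaryGroupOfForm σ J) ∧
      n ∈ (borelTriple σ J hJ).N ∧ g = nb * m * n := by
  obtain ⟨nb, b, hnbI, hnbN, hbI, hbB, hg'⟩ := exists_lowerU_mul_borel_of_mem_inf_pow σ hJ hσ hvσ hvϖ gn hgn hn hg
  have hbP : b ∈ (borelTriple σ J hJ).P := by rw [borelTriple_P]; exact hbB
  set m : ↥(unitaryGroupOfForm σ J) := (((borelTriple σ J hJ).proj ⟨b, hbP⟩ : ↥(borelTriple σ J hJ).M) : ↥(unitaryGroupOfForm σ J)) with hm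
  have hmM : m ∈ (borelTriple σ J hJ).M := ((borelTriple σ J hJ).proj ⟨b, hbP⟩).2
  have hnN : m⁻¹ * b ∈ (borelTriple σ J hJ).N := (borelTriple σ J hJ).proj_inv_mul_mem ⟨b, hbP⟩
  -- `m = diag(bᵢᵢ)` is integral and diagonal: `m ∈ J_n`
  have hbint := (mem_glInt_subgroupOf_iff σ hJ hvσ b).1 (Subgroup.mem_inf.1 hbI).1
  have hmval : ((m : GL (Fin 3) K) : Matrix (Fin 3) (Fin 3) K) = Matrix.diagonal fun i => ((b : GL (Fin 3) K) : Matrix (Fin 3) (Fin 3) K) i i :=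
    val_proj_borelTriple σ J hJ ⟨b, hbP⟩
  have hmK0 : m ∈ (glInt 3 K).subgroupOf (unitaryGroupOfForm σ J) := by
    rw [mem_glInt_subgroupOf_iff σ hJ hvσ, hmval]
    intro i j
    rw [Matrix.diagonal_apply]
    split_ifs with hij
    · exact hbint i i
    · rw [map_zero]; exact zero_le
  have hmI : m ∈ (glInt 3 K).subgroupOf (unitaryGroupOfForm σ J) ⊓ ((glInt 3 K).map (MulAut.conj gn).toMonoidHom).subgroupOf (unitaryGroupOfForm σ J) :=
    mem_glInt_inf_conj_glInt_pow_of_diagonal σ hJ hvσ hvϖ gn hgn hmK0 hmval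
  refine ⟨nb, m, m⁻¹ * b, hnbI, hnbN, hmI, hmM, Subgroup.mul_mem _ (Subgroup.inv_mem _ hmI) hbI, hnN, ?_⟩
  rw [hg', mul_assoc, mul_inv_cancel_left]

include hJ hσ hvσ hvϖ hgn in
/-- **THE IWAHORI FACTORISATION OF `J_n` as a set identity** (`1 ≤ n`): `J_n = (J_n ∩ N̄)·(J_n ∩ T)·(J_n ∩ N)` — the `factorization` field of ★ `ParabolicTriple.IwahoriDatum`
for the Borel triple of `U(σ, Φ₃)(K)` at the LEVEL-`n` IWAHORI `J_n = K₀ ⊓ g_nK₀g_n⁻¹` (★ `K2E3IwahoriFactorisationThree.coe_inf_eq_mul` is `n = 1`, ★ `coe_comap_congruenceGL_eq_mul`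
the principal-congruence level). [cite: Casselman1995, Prop. 1.4.4] [cite: BruhatTits1972, (4.4.4)] [cite: Roche1998, §2–§3] -/
theorem coe_inf_pow_eq_mul (hn : 1 ≤ n) :
    (((glInt 3 K).subgroupOf (unitaryGroupOfForm σ J) ⊓ ((glInt 3 K).map (MulAut.conj gn).toMonoidHom).subgroupOf (unitaryGroupOfForm σ J) :
        Subgroup ↥(unitaryGroupOfForm σ J)) : Set ↥(unitaryGroupOfForm σ J)) =
      ((((glInt 3 K).subgroupOf (unitaryGroupOfForm σ J) ⊓ ((glInt 3 K).map (MulAut.conj gn).toMonoidHom).subgroupOf (unitaryGroupOfForm σ J)) ⊓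
          ((borelTriple σ J hJ).N).map (MulAut.conj (weylLongU σ hJ)).toMonoidHom : Subgroup ↥(unitaryGroupOfForm σ J)) : Set ↥(unitaryGroupOfForm σ J)) *
        ((((glInt 3 K).subgroupOf (unitaryGroupOfForm σ J) ⊓ ((glInt 3 K).map (MulAut.conj gn).toMonoidHom).subgroupOf (unitaryGroupOfForm σ J)) ⊓
          (borelTriple σ J hJ).M : Subgroup ↥(unitaryGroupOfForm σ J)) : Set ↥(unitaryGroupOfForm σ J)) *
        ((((glInt 3 K).subgroupOf (unitaryGroupOfForm σ J) ⊓ ((glInt 3 K).map (MulAut.conj gn).toMonoidHom).subgroupOf (unitaryGroupOfForm σ J)) ⊓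
          (borelTriple σ J hJ).N : Subgroup ↥(unitaryGroupOfForm σ J)) : Set ↥(unitaryGroupOfForm σ J)) := by
  ext g
  constructor
  · intro hg
    obtain ⟨nb, m, n', hnbI, hnbN, hmI, hmM, hnI, hnN, rfl⟩ := exists_nbar_mul_torus_mul_unipotent_of_mem_inf_pow σ hJ hσ hvσ hvϖ gn hgn hn hg
    exact Set.mul_mem_mul (Set.mul_mem_mul (Subgroup.mem_inf.2 ⟨hnbI, hnbN⟩) (Subgroup.mem_inf.2 ⟨hmI, hmM⟩)) (Subgroup.mem_inf.2 ⟨hnI, hnN⟩)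
  · rintro ⟨_, ⟨nb, hnb, m, hm, rfl⟩, n', hn', rfl⟩
    exact Subgroup.mul_mem _ (Subgroup.mul_mem _ (Subgroup.mem_inf.1 hnb).1 (Subgroup.mem_inf.1 hm).1) (Subgroup.mem_inf.1 hn').1

end Summit.HodgeConjecture.HodgeConjecture.Cruxes.H413.K2E3IwahoriLevelNFactorisation

end
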